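import Summits.Ventures.YMGap.RobustBall.ConcentrationBall
import Summits.Ventures.YMGap.RobustBall.ErgodicAverages
import Summits.Ventures.YMGap.RobustBall.OneStateInvariant
import Mathlib.MeasureTheory.OuterMeasure.BorelCantelli
import HarnessLib

/-!
# Venture YMGap, track ROBUST-BALL — COMPLETE CONVERGENCE of the cube averages at the Wilson point: exponentially small tails, summable in the
# cube size, hence almost-sure convergence by the first Borel–Cantelli lemma (SU(2), `ℤ⁴`, `β_W ≤ 1/12`)

HONEST FRAMING. WHAT THIS IS: a venture file (cell `pub-ymgap`, track Y2 ROBUST-BALL, seat ds-3, theorems only), the junction of g13's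
Gaussian concentration on the tier-1 ball (`ConcentrationBall.su2_wilson_translates_average_upTo_oneTwelfth`) with this seat's ergodic
averages (`ErgodicAverages`). GENERIC (`ae_tendsto_of_summable_measure_ge`): a Borel–Cantelli convergence lemma — if for every tolerance
`1/(m+1)` the exceedance probabilities `μ{1/(m+1) ≤ |X_n − L|}` are summable in `n`, then `X_n → L` almost surely. CELL: `SU(2)` lattice
Yang–Mills on `ℤ⁴`, `0 ≤ β_W ≤ 1/12` (tree coupling `β_W/2`; the DLR state `μ` is unique and translation invariant): for every Lipschitz
cylinder observable `f` (links `Δ`, constant `K`) and every `ε > 0`, with `V = 128 K² #Δ² Θ₁²` (`Θ₁ = ((1+2^{−1/4})/(1−2^{−1/4}))⁴`):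

* `su2_wilson_boxAverage_tail_le` — `μ{ε ≤ |#B_n⁻¹ Σ_{x∈B_n} f∘θ_x − ∫ f dμ|} ≤ 2 exp(−2 ε² (2n+1)⁴ / V)` for every cube `B_n = [−n, n]⁴`;
* ★ `su2_wilson_complete_convergence` — these tails are SUMMABLE in `n` (complete convergence in the sense of Hsu–Robbins–Erdős), and
  consequently `#B_n⁻¹ Σ_{x∈B_n} f(θ_x U) → ∫ f dμ` for `μ`-almost every configuration `U`.

The almost-sure statement is also a special case of `ErgodicAverages.su2_wilson_ae_tendsto_boxAverage` (second-moment route, larger window,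
bounded measurable local observables); what is new here is the exponential, summable tail at the Wilson point.
WHAT THIS IS NOT: no large-deviation principle (an upper bound of Gaussian type only), no rate function identified; lattice strong coupling;
nothing about the continuum limit or the Clay problem.

References: P. L. Hsu, H. Robbins, Proc. Nat. Acad. Sci. 33 (1947) 25–31 (complete convergence); C. Külske, Comm. Math. Phys. 239 (2003)
29–51 (concentration for Gibbs measures under Dobrushin uniqueness); the tree's `ConcentrationBall.lean`, `ErgodicAverages.lean`.
-/

noncomputable section

open MeasureTheory Filter Function ProbabilityTheory Real Topology
open scoped NNReal ENNReal
open Literature.Probability.LatticeModels hiding configShift configShift_apply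
open Literature.MathematicalPhysics.QuantumLattice
open Literature.MathematicalPhysics.QuantumFieldTheory hiding ZdEdge Site IsLocalObservable
open Literature.Probability.LatticeModels.DobrushinMetric (integrable_of_abs_le')

namespace Summit.Ventures.YMGap.RobustBall

namespace ErgodicConcentration

/-! ### Generic: summable exceedance probabilities ⇒ almost-sure convergence -/

/-- **Borel–Cantelli convergence lemma**: if for every `m : ℕ` the probabilities `μ{1/(m+1) ≤ |X_n − L|}` have a finite sum over `n`,
then `X_n → L` for `μ`-almost every point. [folklore] -/
theorem ae_tendsto_of_summable_measure_ge {Ω : Type*} [MeasurableSpace Ω] {μ : Measure Ω} {X : ℕ → Ω → ℝ} {L : ℝ}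
    (h : ∀ m : ℕ, ∑' n, μ {ω | (1 : ℝ) / (m + 1) ≤ |X n ω - L|} ≠ ∞) :
    ∀ᵐ ω ∂μ, Tendsto (fun n => X n ω) atTop (𝓝 L) := by
  have hall : ∀ᵐ ω ∂μ, ∀ m : ℕ, ∀ᶠ n in atTop, |X n ω - L| < (1 : ℝ) / (m + 1) := by
    rw [ae_all_iff]
    intro m
    filter_upwards [ae_eventually_notMem (h m)] with ω hω
    exact hω.mono fun n hn => not_le.1 hn
  filter_upwards [hall] with ω hω
  rw [Metric.tendsto_atTop]
  intro ε hε
  obtain ⟨m, hm⟩ := exists_nat_one_div_lt hε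
  obtain ⟨N, hN⟩ := eventually_atTop.1 (hω m)
  exact ⟨N, fun n hn => by rw [Real.dist_eq]; exact (hN n hn).trans hm⟩

/-- A crude summable majorant: `Σ_n e^{−c (2n+1)^4} ≤ Σ_n (e^{−c})^{n+1} < ∞` for `c > 0` (`(2n+1)^4 ≥ n+1`). [folklore] -/
theorem summable_exp_neg_mul_oddPow (c : ℝ) (hc : 0 < c) :
    Summable fun n : ℕ => Real.exp (-(c * (2 * (n : ℝ) + 1) ^ 4)) := by
  have hq0 : 0 ≤ Real.exp (-c) := (Real.exp_pos _).le
  have hq1 : Real.exp (-c) < 1 := Real.exp_lt_one_iff.2 (by linarith)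
  have hgeo : Summable fun n : ℕ => Real.exp (-c) ^ (n + 1) := by
    simpa [pow_succ] using (summable_geometric_of_lt_one hq0 hq1).mul_right (Real.exp (-c))
  refine Summable.of_nonneg_of_le (fun n => (Real.exp_pos _).le) (fun n => ?_) hgeo
  rw [← Real.exp_nat_mul]
  refine Real.exp_le_exp.2 ?_
  have hn : ((n : ℝ) + 1) ≤ (2 * (n : ℝ) + 1) ^ 4 := by
    have h1 : (1 : ℝ) ≤ 2 * (n : ℝ) + 1 := by linarith [Nat.cast_nonneg (α := ℝ) n]
    nlinarith [pow_le_pow_right₀ h1 (show 1 ≤ 4 by norm_num), Nat.cast_nonneg (α := ℝ) n]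
  push_cast
  nlinarith

/-! ### The Wilson point: exponential tails of the cube averages, complete convergence -/

/-- **Exponential tails of the cube averages** (`SU(2)`, `ℤ⁴`, `0 ≤ β_W ≤ 1/12`, translation-invariant DLR state `μ`, Lipschitz cylinder
`f` with constant `K` on the links `Δ`, `|f| ≤ M`): for every cube `B_n = [−n, n]⁴` and every `ε > 0`,
`μ{ε ≤ |#B_n⁻¹ Σ_{x∈B_n} f∘θ_x − ∫ f dμ|} ≤ 2 exp(−2 ε² (2n+1)⁴ / (128 K² #Δ² Θ₁²))`. [folklore] -/
theorem su2_wilson_boxAverage_tail_le {βW : ℝ} (h0 : 0 ≤ βW) (h : βW ≤ 1 / 12)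
    {μ : Measure (LGConfig 4 (Matrix.specialUnitaryGroup (Fin 2) ℂ))}
    (hμ : μ ∈ ymGibbsMeasures (d := 4) (fundamentalRep (Fin 2)) (βW / 2)) (hinv : IsZdTranslationInvariant μ)
    {f : LGConfig 4 (Matrix.specialUnitaryGroup (Fin 2) ℂ) → ℝ} {Δ : Finset (ZdEdge 4)} {K : ℝ≥0}
    (hf : IsLipschitzCylinder (fundamentalRep (Fin 2)) f Δ K) {M : ℝ} (hM : ∀ U, |f U| ≤ M) (n : ℕ) {ε : ℝ} (hε : 0 < ε) :
    μ.real {U | ε ≤ |(∑ x ∈ siteBox 4 n, f (configShift x U)) / (siteBox 4 n).card - ∫ U', f U' ∂μ|} ≤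
      2 * exp (-2 * ε ^ 2 * (2 * (n : ℝ) + 1) ^ 4 / (128 * (K : ℝ) ^ 2 * (Δ.card : ℝ) ^ 2 *
        (((1 + exp (Real.log (1 / 2) / 4)) / (1 - exp (Real.log (1 / 2) / 4))) ^ 4) ^ 2)) := by
  haveI : IsProbabilityMeasure μ := (show IsGibbsMeasure _ μ from hμ).isProbabilityMeasure
  have hB := ErgodicAverages.siteBox_nonempty 4 n
  have hcard : ((siteBox 4 n).card : ℝ) = (2 * (n : ℝ) + 1) ^ 4 := ErgodicAverages.card_siteBox_cast 4 n
  have hBpos : (0 : ℝ) < (siteBox 4 n).card := by exact_mod_cast hB.card_pos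
  have key := su2_wilson_translates_average_upTo_oneTwelfth h0 h hμ hf hB hε.le
  -- the mean of the block sum is `#B · ∫ f` by translation invariance
  have hfi : ∀ x : Site 4, Integrable (fun U => f (configShift x U)) μ := fun x =>
    integrable_of_abs_le' (hf.measurable.comp (configShift x).measurable) fun U => hM _
  have hmean : ∫ U', ∑ x ∈ siteBox 4 n, f (configShift x U') ∂μ = (siteBox 4 n).card * ∫ U', f U' ∂μ := by
    rw [integral_finsetSum _ fun x _ => hfi x]
    simp_rw [ErgodicAverages.integral_comp_shift hinv f]
    rw [Finset.sum_const, nsmul_eq_mul]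
  -- the two events coincide up to the normalisation by `#B`
  have hsub : {U | ε ≤ |(∑ x ∈ siteBox 4 n, f (configShift x U)) / (siteBox 4 n).card - ∫ U', f U' ∂μ|} ⊆
      {U | ε * (siteBox 4 n).card ≤
        |(∑ x ∈ siteBox 4 n, f (configShift x U)) - ∫ U', ∑ x ∈ siteBox 4 n, f (configShift x U') ∂μ|} := by
    intro U hU
    simp only [Set.mem_setOf_eq] at hU ⊢
    rw [hmean]
    have hEq : (∑ x ∈ siteBox 4 n, f (configShift x U)) - (siteBox 4 n).card * ∫ U', f U' ∂μ =
        (siteBox 4 n).card * ((∑ x ∈ siteBox 4 n, f (configShift x U)) / (siteBox 4 n).card - ∫ U', f U' ∂μ) := by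
      field_simp
    rw [hEq, abs_mul, abs_of_pos hBpos, mul_comm]
    exact mul_le_mul_of_nonneg_left hU hBpos.le
  refine (measureReal_mono hsub).trans (key.trans (le_of_eq ?_))
  rw [hcard]

/-- ★ **COMPLETE CONVERGENCE OF THE CUBE AVERAGES AT THE WILSON POINT** (`SU(2)`, `ℤ⁴`, `0 ≤ β_W ≤ 1/12`, tree coupling `β_W/2`): the DLR
states form a singleton `{μ}` (translation invariant), and for every Lipschitz cylinder observable `f` (links `Δ ≠ ∅`, constant `K > 0`,
`|f| ≤ M`) and every `ε > 0`: the exceedance probabilities `μ{ε ≤ |#B_n⁻¹ Σ_{x∈B_n} f∘θ_x − ∫ f dμ|}` are SUMMABLE over the cubes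
`B_n = [−n, n]⁴` (each `≤ 2 exp(−2ε²(2n+1)⁴/V)`), and `#B_n⁻¹ Σ_{x∈B_n} f(θ_x U) → ∫ f dμ` for `μ`-almost every `U`. [folklore] -/
theorem su2_wilson_complete_convergence {βW : ℝ} (h0 : 0 ≤ βW) (h : βW ≤ 1 / 12) :
    ∃ μ : Measure (LGConfig 4 (Matrix.specialUnitaryGroup (Fin 2) ℂ)),
      ymGibbsMeasures (d := 4) (fundamentalRep (Fin 2)) (βW / 2) = {μ} ∧
      ∀ {f : LGConfig 4 (Matrix.specialUnitaryGroup (Fin 2) ℂ) → ℝ} {Δ : Finset (ZdEdge 4)} {K : ℝ≥0},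
        IsLipschitzCylinder (fundamentalRep (Fin 2)) f Δ K → Δ.Nonempty → 0 < K → ∀ {M : ℝ}, (∀ U, |f U| ≤ M) →
        (∀ ε : ℝ, 0 < ε →
          Summable fun n : ℕ =>
            μ.real {U | ε ≤ |(∑ x ∈ siteBox 4 n, f (configShift x U)) / (siteBox 4 n).card - ∫ U', f U' ∂μ|}) ∧
        ∀ᵐ U ∂μ, Tendsto (fun n : ℕ => (∑ x ∈ siteBox 4 n, f (configShift x U)) / (siteBox 4 n).card) atTop
          (𝓝 (∫ U', f U' ∂μ)) := by
  have hb : |βW / 2| ≤ 9 / 50 := by rw [abs_of_nonneg (by linarith)]; linarith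
  obtain ⟨μ, hG, hinv⟩ := su2_wilson_oneState_translationInvariant hb
  have hμ : μ ∈ ymGibbsMeasures (d := 4) (fundamentalRep (Fin 2)) (βW / 2) := by rw [hG]; exact Set.mem_singleton μ
  haveI : IsProbabilityMeasure μ := (show IsGibbsMeasure _ μ from hμ).isProbabilityMeasure
  refine ⟨μ, hG, fun {f} {Δ} {K} hf hΔ hK {M} hM => ?_⟩
  -- the variance proxy `V > 0` and the summable majorant
  set V : ℝ := 128 * (K : ℝ) ^ 2 * (Δ.card : ℝ) ^ 2 *
    (((1 + exp (Real.log (1 / 2) / 4)) / (1 - exp (Real.log (1 / 2) / 4))) ^ 4) ^ 2 with hV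
  have hΘ : 0 < (1 + exp (Real.log (1 / 2) / 4)) / (1 - exp (Real.log (1 / 2) / 4)) := by
    have h1 : exp (Real.log (1 / 2) / 4) < 1 := Real.exp_lt_one_iff.2 (by
      have : Real.log (1 / 2) < 0 := Real.log_neg (by norm_num) (by norm_num)
      linarith)
    exact div_pos (by positivity) (by linarith)
  have hΔ0 : (0 : ℝ) < Δ.card := by exact_mod_cast hΔ.card_pos
  have hK0 : (0 : ℝ) < K := by exact_mod_cast hK
  have hV0 : 0 < V := by positivity
  have htail : ∀ {ε : ℝ}, 0 < ε → ∀ n : ℕ,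
      μ.real {U | ε ≤ |(∑ x ∈ siteBox 4 n, f (configShift x U)) / (siteBox 4 n).card - ∫ U', f U' ∂μ|} ≤
        2 * exp (-(2 * ε ^ 2 / V * (2 * (n : ℝ) + 1) ^ 4)) := by
    intro ε hε n
    refine (su2_wilson_boxAverage_tail_le h0 h hμ hinv hf hM n hε).trans (le_of_eq ?_)
    congr 1
    rw [hV]
    congr 1
    ring
  have hsum : ∀ ε : ℝ, 0 < ε → Summable fun n : ℕ =>
      μ.real {U | ε ≤ |(∑ x ∈ siteBox 4 n, f (configShift x U)) / (siteBox 4 n).card - ∫ U', f U' ∂μ|} := by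
    intro ε hε
    refine Summable.of_nonneg_of_le (fun n => measureReal_nonneg) (fun n => htail hε n) ?_
    exact (summable_exp_neg_mul_oddPow (2 * ε ^ 2 / V) (by positivity)).mul_left 2
  refine ⟨hsum, ae_tendsto_of_summable_measure_ge fun m => ?_⟩
  -- Borel–Cantelli input: the `ENNReal` sum of the exceedance probabilities is finite
  have hε : (0 : ℝ) < 1 / (m + 1) := by positivity
  set S : ℕ → Set (LGConfig 4 (Matrix.specialUnitaryGroup (Fin 2) ℂ)) := fun n =>
    {U | (1 : ℝ) / (m + 1) ≤ |(∑ x ∈ siteBox 4 n, f (configShift x U)) / (siteBox 4 n).card - ∫ U', f U' ∂μ|} with hS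
  have hconv : ∀ n, μ (S n) = ENNReal.ofReal (μ.real (S n)) := fun n => (ofReal_measureReal (measure_ne_top μ _)).symm
  show ∑' n, μ (S n) ≠ ∞
  simp_rw [hconv]
  rw [← ENNReal.ofReal_tsum_of_nonneg (fun n => measureReal_nonneg) (hsum _ hε)]
  exact ENNReal.ofReal_ne_top

end ErgodicConcentration

end Summit.Ventures.YMGap.RobustBall

end
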